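import Literature.RepresentationTheory.CompactGroups.KTypeMultiplicityOneOfCommutingOrbital
import Literature.RepresentationTheory.KonnoKonno2007.UnitaryTwoOneOrbitalCommute
import Literature.RepresentationTheory.IrreducibleTwistTransport
import Literature.NumberTheory.Automorphic.GKModules
import HarnessLib

/-!
# Harish-Chandra's admissibility theorem for `U(2,1)`: `isAdmissibleGK_of_irreducible_unitary (uFormGroup (Fin 2) (Fin 1)) σ`

Topic `NumberTheory/Automorphic`; namespace `Literature.NumberTheory.Automorphic` (the vocabulary of ★ `GKModules`).  Theorems only;
no definition, no instance, no named fact, no `sorry`.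

★ `GKModules.isAdmissibleGK_of_irreducible_unitary G ϖ` is the tree's named statement of Harish-Chandra's theorem
[HarishChandra1953, Thms. 4–6]: every irreducible unitary representation `ϖ` of the linear real group `G` is ADMISSIBLE — each
irreducible `K`-type has finite multiplicity in the Harish-Chandra module (`IsAdmissibleGK (harishChandraRepK G ϖ)`).  This file
PROVES it for `G = U(2,1) = uFormGroup (Fin 2) (Fin 1)`:

  **`isAdmissibleGK_of_irreducible_unitary_uFormGroup_two_one (σ) : isAdmissibleGK_of_irreducible_unitary (uFormGroup (Fin 2) (Fin 1)) σ`**,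

in the sharp form «multiplicity ≤ 1» (Kraljević 1973, Koornwinder 1982: `(U(n,1), U(n) × U(1))` is a strong Gelfand pair), by the
road «T3 via Gelfand's trick»: ★ `RealDualPair.commute_orbitalOp_uFormGroup_two_one` (the orbital operators
`O_x = ∫_K σ(k x k⁻¹) dk` of every unitary representation of `U(2,1)` commute — Gelfand's trick for the transpose over ★ KAK) and
★ `CompactGroups.exists_forall_homSpace_eq_smul_of_commute_orbitalOp` (commuting `O_x` ⇒ `Hom_K(τ, σ|_K)` is at most a line, for
every finite-dimensional irreducible unitary `τ`).  The remaining bookkeeping, done here: an ABSTRACT irreducible `K`-type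
`τ : Representation ℂ K W` (no topology on `W`) with a non-zero intertwiner `j₀` into the Harish-Chandra space is realised, through the
injective `j₀` (irreducibility), on the finite-dimensional `K`-stable subspace `U₀ = range j₀ ≤ H` (a unitary continuous `K`-representation
`τ'`, irreducible by ★ `Representation.isIrreducible_iff_of_equivariant` along `K ≃ U(2) × U(1)`, ★ `upqMaximalCompactEquiv`), and
`Hom_K(τ, H_K^∞) ↪ Hom_K(τ', σ|_K)` linearly; NO elliptic regularity, PI-algebra or subquotient theorem is used.

CONSUMER: the registered stub `stub_T3` of the closer `Cruxes/H413/Lines/F0_U3LettersRung1.lean` ED. 21 (block (H), «ABS ⟸ T3»,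
★ `F0P3ArchBlockStructureOfT3.archBlockStructure_of_isAdmissibleGK_of_irreducible_unitary`), whose text is byte-for-byte the universal
closure of this theorem over `E`.

* `haarTop_isMulRightInvariant`, `haarTop_isInvInvariant` (private: compact groups are unimodular);
* **`isAdmissibleGK_of_irreducible_unitary_uFormGroup_two_one`**.

## References
* Harish-Chandra, *Representations of a semisimple Lie group on a Banach space. I*, Trans. AMS 75 (1953), 185–243, Thms. 4–6
  [HarishChandra1953].
* S. Helgason, *Groups and Geometric Analysis*, AMS (2000), Ch. IV §3, Thm. 3.1 (Gelfand's lemma) [Helgason2000].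
* A. Deitmar, S. Echterhoff, *Principles of Harmonic Analysis*, 2nd ed. (2014), §7.3 Lemma 7.3.1 (multiplicity spaces) [DeitmarEchterhoff2014].

## Provenance
Cell `hodgecm-mathlib`, seat A-p14 (g27), road «T3 via Gelfand's trick», FILE D2 (assembly).  HC_CM is proved only modulo the remaining
named inputs (hLiu418, h413) until rung 0 closes; this file proves ONE registered letter (`stub_T3`) and changes the books only there.
-/

set_option autoImplicit false

noncomputable section

open MeasureTheory Measure ContRepresentation
open Literature.RepresentationTheory.CompactGroups Literature.RepresentationTheory.KonnoKonno2007
open Literature.RepresentationTheory.KonnoKonno2007.RealDualPair Literature.RepresentationTheory.BorelWallach2000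
open scoped InnerProductSpace

namespace Literature.NumberTheory.Automorphic

/-! ### Compact groups are unimodular (right and inversion invariance of the Haar probability measure) -/

section Haar

variable {K : Type*} [Group K] [TopologicalSpace K] [IsTopologicalGroup K] [CompactSpace K] [MeasurableSpace K]
  [BorelSpace K]

/-- The Haar probability measure of a compact group is right invariant (`x g = g · (g⁻¹ x g)`: conjugation invariance by
`MonoidHom.measurePreserving` and left invariance). [folklore] -/
private theorem haarTop_isMulRightInvariant :
    (haarMeasure (⊤ : TopologicalSpace.PositiveCompacts K)).IsMulRightInvariant := by
  have hconj : ∀ g : K, MeasurePreserving (fun x => g * x * g⁻¹) (haarMeasure (⊤ : TopologicalSpace.PositiveCompacts K))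
      (haarMeasure (⊤ : TopologicalSpace.PositiveCompacts K)) := fun g =>
    (MulAut.conj g).toMonoidHom.measurePreserving ((continuous_const.mul continuous_id).mul continuous_const)
      (MulAut.conj g).surjective rfl
  constructor
  intro g
  have h1 : (fun x : K => x * g) = (fun x => g * x) ∘ fun x => g⁻¹ * x * g⁻¹⁻¹ := by
    ext x; simp [mul_assoc]
  rw [h1, ← Measure.map_map (measurable_const_mul g) (hconj g⁻¹).measurable, (hconj g⁻¹).map_eq, map_mul_left_eq_self]

/-- The Haar probability measure of a compact group is invariant under inversion (`μ.inv` is left invariant, hence a multiple of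
`μ` with the same total mass). [folklore] -/
private theorem haarTop_isInvInvariant :
    (haarMeasure (⊤ : TopologicalSpace.PositiveCompacts K)).IsInvInvariant := by
  haveI := haarTop_isMulRightInvariant (K := K)
  constructor
  set μ := haarMeasure (⊤ : TopologicalSpace.PositiveCompacts K)
  have hc : μ.inv = haarScalarFactor μ.inv μ • μ := isMulLeftInvariant_eq_smul_of_regular μ.inv μ
  have h1 : μ.inv Set.univ = 1 := by
    rw [Measure.inv, Measure.map_apply measurable_inv MeasurableSet.univ, Set.preimage_univ, ← TopologicalSpace.PositiveCompacts.coe_top]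
    exact haarMeasure_self
  have h2 : haarScalarFactor μ.inv μ = 1 := by
    have h := congrArg (fun ν : Measure K => ν Set.univ) hc
    simp only [Measure.smul_apply, h1, ENNReal.smul_def, smul_eq_mul] at h
    rw [← TopologicalSpace.PositiveCompacts.coe_top, haarMeasure_self, mul_one] at h
    exact ENNReal.coe_eq_one.1 h.symm
  rw [hc, h2, one_smul]

end Haar

/-! ### Harish-Chandra admissibility for `U(2,1)` -/

/-- **Harish-Chandra's admissibility theorem for `U(2,1)`** [HarishChandra1953, Thms. 4–6], at the tree's letter
★ `isAdmissibleGK_of_irreducible_unitary (uFormGroup (Fin 2) (Fin 1)) σ`: for every irreducible unitary strongly continuous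
representation `σ` of `U(2,1)` on a Hilbert space, every irreducible `K`-type (`K = U(2,1) ∩ U(3) ≅ U(2) × U(1)`) occurs in the
Harish-Chandra module `H_K^∞` with finite multiplicity — in fact with multiplicity `≤ 1` (Gelfand's trick for the transpose: ★
`commute_orbitalOp_uFormGroup_two_one` + ★ `exists_forall_homSpace_eq_smul_of_commute_orbitalOp`). [cite: HarishChandra1953, Thms. 4–6] -/
theorem isAdmissibleGK_of_irreducible_unitary_uFormGroup_two_one {E : Type} [NormedAddCommGroup E] [InnerProductSpace ℂ E]
    [CompleteSpace E] (σ : ContRepresentation ℂ (uFormGroup (Fin 2) (Fin 1)).carrier E) :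
    isAdmissibleGK_of_irreducible_unitary (uFormGroup (Fin 2) (Fin 1)) σ := by
  intro _ _ _hA _hG hU hc hirr W _ _ _ τ hτ
  classical
  haveI := hτ
  /- (1) the compact group `K₀ = U(2) × U(1)`, its Haar probability measure, and its embedding `ιK` into `U(2,1)` -/
  haveI : CompactSpace ↥(Matrix.unitaryGroup (Fin 2) ℂ) := isCompact_iff_compactSpace.mp Matrix.isCompact_unitaryGroup
  haveI : CompactSpace ↥(Matrix.unitaryGroup (Fin 1) ℂ) := isCompact_iff_compactSpace.mp Matrix.isCompact_unitaryGroup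
  haveI : SecondCountableTopology (Matrix (Fin 2) (Fin 2) ℂ) := inferInstanceAs (SecondCountableTopology (Fin 2 → Fin 2 → ℂ))
  haveI : SecondCountableTopology (Matrix (Fin 1) (Fin 1) ℂ) := inferInstanceAs (SecondCountableTopology (Fin 1 → Fin 1 → ℂ))
  haveI : SecondCountableTopology ↥(Matrix.unitaryGroup (Fin 2) ℂ) := TopologicalSpace.Subtype.secondCountableTopology _
  haveI : SecondCountableTopology ↥(Matrix.unitaryGroup (Fin 1) ℂ) := TopologicalSpace.Subtype.secondCountableTopology _
  haveI : SecondCountableTopology (KV (Fin 2) (Fin 1)) := inferInstance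
  letI : MeasurableSpace (KV (Fin 2) (Fin 1)) := borel _
  haveI : BorelSpace (KV (Fin 2) (Fin 1)) := ⟨rfl⟩
  set μ : Measure (KV (Fin 2) (Fin 1)) := haarMeasure ⊤ with hμ
  haveI : IsProbabilityMeasure μ := ⟨by rw [hμ, ← TopologicalSpace.PositiveCompacts.coe_top]; exact haarMeasure_self⟩
  haveI : μ.IsMulRightInvariant := haarTop_isMulRightInvariant
  haveI : μ.IsInvInvariant := haarTop_isInvInvariant
  set ιK : KV (Fin 2) (Fin 1) →* ↥(uFormGroup (Fin 2) (Fin 1)).carrier :=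
    (Subgroup.inclusion (uFormGroup (Fin 2) (Fin 1)).maximalCompact_le_carrier).comp
      (upqMaximalCompactEquiv (α := Fin 2) (β := Fin 1)).symm.toMulEquiv.toMonoidHom with hιK
  have hι : Continuous ιK :=
    (Continuous.subtype_mk continuous_subtype_val _).comp (upqMaximalCompactEquiv (α := Fin 2) (β := Fin 1)).symm.continuous
  /- (2) Gelfand's trick: the orbital operators of `σ` commute -/
  have hcomm : ∀ x y : ↥(uFormGroup (Fin 2) (Fin 1)).carrier,
      Commute (orbitalOp μ ιK σ hι hc hU x) (orbitalOp μ ιK σ hι hc hU y) :=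
    commute_orbitalOp_uFormGroup_two_one (β := Fin 1) μ σ hc hU hι
  /- (3) the `K`-type: either no non-zero intertwiner, or realise `τ` inside `E` -/
  by_cases h0 : ∀ j : τ.IntertwiningMap (harishChandraRepK (uFormGroup (Fin 2) (Fin 1)) σ), j = 0
  · exact Module.Finite.of_surjective
      (LinearMap.toSpanSingleton ℂ (τ.IntertwiningMap (harishChandraRepK (uFormGroup (Fin 2) (Fin 1)) σ)) 0)
      fun j => ⟨0, by rw [h0 j, LinearMap.toSpanSingleton_apply, zero_smul]⟩
  push Not at h0
  obtain ⟨j₀, hj₀⟩ := h0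
  have hj₀inj : Function.Injective j₀ := (Representation.IsIrreducible.injective_or_eq_zero j₀).resolve_right hj₀
  -- the realisation `f = incl ∘ j₀ : W → E`, its range `U₀` and the transport `e₀ : W ≃ U₀`
  let f : W →ₗ[ℂ] E := (harishChandraSpace (uFormGroup (Fin 2) (Fin 1)) σ).subtype ∘ₗ j₀.toLinearMap
  have hfapply : ∀ w, f w = ((j₀ w : harishChandraSpace (uFormGroup (Fin 2) (Fin 1)) σ) : E) := fun w => rfl
  have hfinj : Function.Injective f := Subtype.val_injective.comp hj₀inj
  let U₀ : Submodule ℂ E := LinearMap.range f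
  let e₀ : W ≃ₗ[ℂ] ↥U₀ := LinearEquiv.ofInjective f hfinj
  have he₀apply : ∀ w, ((e₀ w : ↥U₀) : E) = f w := fun w => LinearEquiv.ofInjective_apply f (h := hfinj) w
  -- equivariance of `f` along `ιK`
  have hfK : ∀ (k : KV (Fin 2) (Fin 1)) (w : W),
      σ (ιK k) (f w) = f (τ ((upqMaximalCompactEquiv (α := Fin 2) (β := Fin 1)).symm k) w) := by
    intro k w
    rw [hfapply, hfapply, j₀.isIntertwining]
    rfl
  -- `U₀` is `K`-stable: a closed subrepresentation of `σ ∘ ιK`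
  have hU₀K : ∀ (k : KV (Fin 2) (Fin 1)) {u : E}, u ∈ U₀ → (σ.restrict ιK) k u ∈ U₀ := by
    rintro k _ ⟨w, rfl⟩
    exact ⟨τ ((upqMaximalCompactEquiv (α := Fin 2) (β := Fin 1)).symm k) w, (hfK k w).symm⟩
  let Uc : ClosedSubrep (σ.restrict ιK) :=
    { toSubmodule := U₀
      apply_mem_toSubmodule := fun k u hu => hU₀K k hu
      isClosed' := Submodule.closed_of_finiteDimensional U₀ }
  let τ' : ContRepresentation ℂ (KV (Fin 2) (Fin 1)) ↥U₀ := Uc.toContRep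
  have hτ'apply : ∀ (k : KV (Fin 2) (Fin 1)) (u : ↥U₀), ((τ' k u : ↥U₀) : E) = σ (ιK k) (u : E) := fun k u => rfl
  let ρ' : Representation ℂ (KV (Fin 2) (Fin 1)) ↥U₀ := τ'.toRepresentation
  have hρ'apply : ∀ (k : KV (Fin 2) (Fin 1)) (u : ↥U₀), ρ' k u = τ' k u := fun k u => rfl
  -- `e₀` is equivariant along `K ≃ U(2) × U(1)`
  have he : ∀ (k : ↥(uFormGroup (Fin 2) (Fin 1)).maximalCompact) (w : W),
      e₀ (τ k w) = ρ' ((upqMaximalCompactEquiv (α := Fin 2) (β := Fin 1)) k) (e₀ w) := by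
    intro k w
    rw [hρ'apply]
    apply Subtype.ext
    rw [hτ'apply, he₀apply, he₀apply, hfK, ContinuousMulEquiv.symm_apply_apply]
  -- `τ'` is irreducible and unitary
  haveI : ρ'.IsIrreducible :=
    (Representation.isIrreducible_iff_of_equivariant τ ρ'
      (upqMaximalCompactEquiv (α := Fin 2) (β := Fin 1)).toMulEquiv.toMonoidHom
      (upqMaximalCompactEquiv (α := Fin 2) (β := Fin 1)).surjective e₀ he).mp hτ
  have hτ'u : ∀ (k : KV (Fin 2) (Fin 1)) (v w : ↥U₀), ⟪τ' k v, τ' k w⟫_ℂ = ⟪v, w⟫_ℂ := by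
    intro k v w
    rw [Submodule.coe_inner, Submodule.coe_inner, hτ'apply, hτ'apply]
    exact hU.inner_map_map _ _ _
  /- (4) multiplicity one in the multiplicity space of `τ'` -/
  obtain ⟨S₀, hS₀⟩ := exists_forall_homSpace_eq_smul_of_commute_orbitalOp (τ := τ') hirr hcomm hτ'u
  haveI : FiniteDimensional ℂ (HomSpace τ' (σ.restrict ιK)) :=
    Module.Finite.of_surjective (LinearMap.toSpanSingleton ℂ (HomSpace τ' (σ.restrict ιK)) S₀) fun S => by
      obtain ⟨c, hcS⟩ := hS₀ S
      exact ⟨c, by rw [LinearMap.toSpanSingleton_apply, hcS]⟩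
  /- (5) `Hom_K(τ, H_K^∞) ↪ Hom_K(τ', σ ∘ ιK)`, `j ↦ incl ∘ j ∘ e₀⁻¹` -/
  have hmem : ∀ j : τ.IntertwiningMap (harishChandraRepK (uFormGroup (Fin 2) (Fin 1)) σ),
      LinearMap.toContinuousLinearMap
          ((harishChandraSpace (uFormGroup (Fin 2) (Fin 1)) σ).subtype ∘ₗ j.toLinearMap ∘ₗ (e₀.symm : ↥U₀ →ₗ[ℂ] W)) ∈
        Schur.intertwiners τ' (σ.restrict ιK) := by
    intro j k
    refine ContinuousLinearMap.ext fun u => ?_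
    -- `u = e₀ w`
    obtain ⟨w, rfl⟩ : ∃ w, u = e₀ w := ⟨e₀.symm u, (e₀.apply_symm_apply u).symm⟩
    have hk : τ' k (e₀ w) = e₀ (τ ((upqMaximalCompactEquiv (α := Fin 2) (β := Fin 1)).symm k) w) := by
      rw [he, ContinuousMulEquiv.apply_symm_apply, hρ'apply]
    change (σ.restrict ιK) k (((j (e₀.symm (e₀ w)) : harishChandraSpace (uFormGroup (Fin 2) (Fin 1)) σ) : E)) =
      ((j (e₀.symm (τ' k (e₀ w))) : harishChandraSpace (uFormGroup (Fin 2) (Fin 1)) σ) : E)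
    rw [hk, LinearEquiv.symm_apply_apply, LinearEquiv.symm_apply_apply, j.isIntertwining]
    rfl
  let Φ : τ.IntertwiningMap (harishChandraRepK (uFormGroup (Fin 2) (Fin 1)) σ) →ₗ[ℂ] HomSpace τ' (σ.restrict ιK) :=
    { toFun := fun j => HomSpace.mk _ (hmem j)
      map_add' := fun j j' => HomSpace.ext (ContinuousLinearMap.ext fun u => rfl)
      map_smul' := fun c j => HomSpace.ext (ContinuousLinearMap.ext fun u => rfl) }
  have hΦapply : ∀ (j : τ.IntertwiningMap (harishChandraRepK (uFormGroup (Fin 2) (Fin 1)) σ)) (w : W),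
      (Φ j).toCLM (e₀ w) = ((j w : harishChandraSpace (uFormGroup (Fin 2) (Fin 1)) σ) : E) := by
    intro j w
    change ((j (e₀.symm (e₀ w)) : harishChandraSpace (uFormGroup (Fin 2) (Fin 1)) σ) : E) = _
    rw [LinearEquiv.symm_apply_apply]
  have hΦinj : Function.Injective Φ := by
    intro j j' hjj'
    apply Representation.IntertwiningMap.toLinearMap_injective
    refine LinearMap.ext fun w => ?_
    have hw := congrArg (fun T : HomSpace τ' (σ.restrict ιK) => T.toCLM (e₀ w)) hjj'
    simp only [hΦapply] at hw
    exact Subtype.ext hw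
  exact FiniteDimensional.of_injective Φ hΦinj

end Literature.NumberTheory.Automorphic

end
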